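import Summits.SmoothPoincare4.SmoothPoincare4.Theorems.SymplecticOrigamiGromovRecognitionRelEndStubCapModelCap1

/-!
# Wedge cap for `GromovRecognitionRelEnd` — gluing the two sphere charts: `C₁ = OV ∪ OH`
(stub `stub_capModel` of line `cross-cap-laurent`, crux `SymplecticOrigami.GromovRecognitionRelEnd`,
item stmt-SmoothPoincare4-11009)

The charts `(u, z₂)` (`u = 1/z₁`) and `(z₁, t)` (`t = 1/z₂`) of `ℂP¹ × ℂP¹` overlap in
`{z₁ ≠ 0, ∞} × {z₂ ≠ 0, ∞}`; inside the pieces `OV = {|u| < R₁⁻¹} × ℂ`, `OH = ℂ × {|t| < R₁⁻¹}` the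
overlap is `{u ≠ 0, |z₂| > R₁} ≅ {|z₁| > R₁, t ≠ 0}` and the transition is the double inversion
`inv12 (u, z₂) = (1/u, 1/z₂)` (an involution). This file builds the gluing datum `dVH`
(`Literature.Topology.FourManifolds.SmoothGlueData`), the first stage `C₁ = OV ∪_{inv12} OH` of the
cap, proves it Hausdorff (closed graph: on the graph `|u|²|z₁|² = 1 = |z₂|²|t|²`), and glues the
complex structures (`inv12` is holomorphic) and the cap forms (`inv12^* ΩH|_{OH} = ΩV|_{OV}`) to
`J₁`, `β₁` on `C₁` (smooth, closed, taming).
-/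

noncomputable section

-- the registered namespace `Summit.SmoothPoincare4.SmoothPoincare4.Theorems…` repeats a component
set_option linter.dupNamespace false

open scoped Manifold ContDiff Topology
open Set Function Filter TopologicalSpace Literature.Geometry.Kaehler Literature.Geometry.Symplectic
  Literature.Topology.FourManifolds

namespace Summit.SmoothPoincare4.SmoothPoincare4.Theorems.GromovRecognitionRelEnd.CrossCapLaurent

namespace CapModel

/-- Model space `ℝ⁴ = ℂ²` (coordinates `0,1` = `z₁`, `2,3` = `z₂`). -/
local notation "E4" => EuclideanSpace ℝ (Fin 4)

/-! ## A closed-graph criterion -/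

/-- **Closed-graph criterion.** The graph of a partial homeomorphism into a Hausdorff space is
closed as soon as its closure projects into the (open) source: near a closure point `(a, b)`
with `a ∈ source`, graph points `(a', e a')` have `e a'` near `e a`, so `b = e a`. [folklore] -/
theorem isClosed_graph_of_closure_subset {A B : Type*} [TopologicalSpace A] [TopologicalSpace B]
    [T2Space B] (e : OpenPartialHomeomorph A B)
    (h : ∀ p ∈ closure {p : A × B | p.1 ∈ e.source ∧ e p.1 = p.2}, p.1 ∈ e.source) :
    IsClosed {p : A × B | p.1 ∈ e.source ∧ e p.1 = p.2} := by
  refine isClosed_of_closure_subset fun p hp => ?_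
  have ha : p.1 ∈ e.source := h p hp
  refine ⟨ha, ?_⟩
  by_contra hne
  obtain ⟨V₁, V₂, hV₁, hV₂, h₁, h₂, hdisj⟩ := t2_separation hne
  have hN : e ⁻¹' V₁ ∩ e.source ∈ 𝓝 p.1 :=
    Filter.inter_mem ((e.continuousAt ha).preimage_mem_nhds (hV₁.mem_nhds h₁))
      (e.open_source.mem_nhds ha)
  have hW : (e ⁻¹' V₁ ∩ e.source) ×ˢ V₂ ∈ 𝓝 p := by
    rw [← Prod.mk.eta (p := p), nhds_prod_eq]
    exact Filter.prod_mem_prod hN (hV₂.mem_nhds h₂)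
  obtain ⟨q, ⟨hq1, hq2⟩, -, hq⟩ := mem_closure_iff_nhds.1 hp _ hW
  exact Set.disjoint_left.1 hdisj (hq ▸ hq1.1) hq2

/-! ## The double inversion -/

/-- `inv12 (z₁, z₂) = (1/z₁, 1/z₂)`. [folklore] -/
def inv12 (p : E4) : E4 := inv2 (inv1 p)

/-- Unfolding. [folklore] -/
theorem inv12_def (p : E4) : inv12 p = inv2 (inv1 p) := rfl

/-- `|inv12 p|₁² = |z₁|⁻²`. [folklore] -/
@[simp] theorem r1_inv12 (p : E4) : r1 (inv12 p) = (r1 p)⁻¹ := by rw [inv12, r1_inv2, r1_inv1]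
/-- `|inv12 p|₂² = |z₂|⁻²`. [folklore] -/
@[simp] theorem r2_inv12 (p : E4) : r2 (inv12 p) = (r2 p)⁻¹ := by rw [inv12, r2_inv2, r2_inv1]

/-- `inv12` is an involution off the axes. [folklore] -/
theorem inv12_inv12 {p : E4} (h1 : r1 p ≠ 0) (h2 : r2 p ≠ 0) : inv12 (inv12 p) = p := by
  rw [inv12, inv12, inv1_inv2 (inv1 p), inv2_inv2 (by rwa [r2_inv1, r2_inv1]), inv1_inv1 h1]

/-- `inv12` is smooth off the axes. [folklore] -/
theorem contDiffAt_inv12 {p : E4} (h1 : r1 p ≠ 0) (h2 : r2 p ≠ 0) : ContDiffAt ℝ ∞ inv12 p :=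
  (contDiffAt_inv2 (p := inv1 p) (by rwa [r2_inv1])).comp p (contDiffAt_inv1 h1)

/-- **`inv12` is holomorphic**: its derivative commutes with `i ⊕ i` off the axes. [folklore] -/
theorem fderiv_inv12_I4 {p : E4} (h1 : r1 p ≠ 0) (h2 : r2 p ≠ 0) (q : E4) :
    fderiv ℝ inv12 p (I4 q) = I4 (fderiv ℝ inv12 p q) := by
  have hd1 := differentiableAt_inv1 h1
  have hd2 : DifferentiableAt ℝ inv2 (inv1 p) := differentiableAt_inv2 (by rwa [r2_inv1])
  rw [show inv12 = inv2 ∘ inv1 from rfl, fderiv_comp p hd2 hd1]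
  simp only [ContinuousLinearMap.coe_comp, Function.comp_apply]
  rw [fderiv_inv1_I4 h1, fderiv_inv2_I4 (by rwa [r2_inv1])]

variable {R₁ : ℝ} [hR : Fact (0 < R₁)]

/-! ## The gluing region and the gluing maps -/

/-- On `{u ≠ 0, R₁² < |z₂|²} ⊆ OV`, `inv12` lands in `dH`, off the axis, beyond `R₁`. [folklore] -/
theorem inv12_mapsV {p : E4} (hV : p ∈ OV R₁) (h1 : r1 p ≠ 0) (h2 : R₁ ^ 2 < r2 p) :
    inv12 p ∈ OH R₁ ∧ r2 (inv12 p) ≠ 0 ∧ R₁ ^ 2 < r1 (inv12 p) := by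
  refine ⟨?_, ?_, ?_⟩
  · rw [mem_OH, r2_inv12, ← r2_inv2]; exact r2_inv2_lt hR.out h2
  · rw [r2_inv12]; exact inv_ne_zero (r2_ne_zero_of_sq_lt h2)
  · rw [r1_inv12, ← r1_inv1]; exact sq_lt_r1_inv1 h1 hV

/-- On `{t ≠ 0, R₁² < |z₁|²} ⊆ OH`, `inv12` lands in `dV`, off the axis, beyond `R₁`. [folklore] -/
theorem inv12_mapsH {p : E4} (hH : p ∈ OH R₁) (h2 : r2 p ≠ 0) (h1 : R₁ ^ 2 < r1 p) :
    inv12 p ∈ OV R₁ ∧ r1 (inv12 p) ≠ 0 ∧ R₁ ^ 2 < r2 (inv12 p) := by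
  refine ⟨?_, ?_, ?_⟩
  · rw [mem_OV, r1_inv12, ← r1_inv1]; exact r1_inv1_lt hR.out h1
  · rw [r1_inv12]; exact inv_ne_zero (r1_ne_zero_of_sq_lt h1)
  · rw [r2_inv12, ← r2_inv2]; exact sq_lt_r2_inv2 h2 hH

/-- The gluing map `OV ⇀ OH`, `(u, z₂) ↦ (1/u, 1/z₂)` (junk off the gluing region). [folklore] -/
def glueVHFun (b : OV R₁) : OH R₁ := mkH (inv12 b.1)

/-- The inverse gluing map `OH ⇀ OV`, `(z₁, t) ↦ (1/z₁, 1/t)`. [folklore] -/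
def glueHVFun (b : OH R₁) : OV R₁ := mkV (inv12 b.1)

/-- `glueVHFun` is the piece map of `inv12`. [folklore] -/
theorem glueVHFun_eq : (glueVHFun : OV R₁ → OH R₁) = toOpens (OH R₁) oH ∘ inv12 ∘ Subtype.val := rfl

/-- `glueHVFun` is the piece map of `inv12`. [folklore] -/
theorem glueHVFun_eq : (glueHVFun : OH R₁ → OV R₁) = toOpens (OV R₁) oV ∘ inv12 ∘ Subtype.val := rfl

/-- **The gluing partial homeomorphism** `OV ⇀ OH` of the two sphere charts (source
`{u ≠ 0, R₁ < |z₂|}`, target `{R₁ < |z₁|, t ≠ 0}`, both maps `inv12`). [folklore] -/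
def glueVH : OpenPartialHomeomorph (OV R₁) (OH R₁) where
  toFun := glueVHFun
  invFun := glueHVFun
  source := {b | r1 b.1 ≠ 0 ∧ R₁ ^ 2 < r2 b.1}
  target := {b | r2 b.1 ≠ 0 ∧ R₁ ^ 2 < r1 b.1}
  map_source' b hb := by
    obtain ⟨hm, h2, h1⟩ := inv12_mapsV b.2 hb.1 hb.2
    simp only [mem_setOf_eq, glueVHFun, mkH, val_toOpens hm]
    exact ⟨h2, h1⟩
  map_target' b hb := by
    obtain ⟨hm, h1, h2⟩ := inv12_mapsH b.2 hb.1 hb.2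
    simp only [mem_setOf_eq, glueHVFun, mkV, val_toOpens hm]
    exact ⟨h1, h2⟩
  left_inv' b hb := by
    obtain ⟨hm, -, -⟩ := inv12_mapsV b.2 hb.1 hb.2
    apply Subtype.ext
    simp only [glueHVFun, glueVHFun, mkH, mkV, val_toOpens hm]
    rw [val_toOpens (by rw [inv12_inv12 hb.1 (r2_ne_zero_of_sq_lt hb.2)]; exact b.2),
      inv12_inv12 hb.1 (r2_ne_zero_of_sq_lt hb.2)]
  right_inv' b hb := by
    obtain ⟨hm, -, -⟩ := inv12_mapsH b.2 hb.1 hb.2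
    apply Subtype.ext
    simp only [glueHVFun, glueVHFun, mkH, mkV, val_toOpens hm]
    rw [val_toOpens (by rw [inv12_inv12 (r1_ne_zero_of_sq_lt hb.2) hb.1]; exact b.2),
      inv12_inv12 (r1_ne_zero_of_sq_lt hb.2) hb.1]
  open_source := (isOpen_r1_ne.preimage continuous_subtype_val).inter
    ((isOpen_lt continuous_const continuous_r2).preimage continuous_subtype_val)
  open_target := (isOpen_r2_ne.preimage continuous_subtype_val).inter
    ((isOpen_lt continuous_const continuous_r1).preimage continuous_subtype_val)
  continuousOn_toFun b hb := (contMDiffAt_pieceMap (x₀ := oH)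
    (contDiffAt_inv12 hb.1 (r2_ne_zero_of_sq_lt hb.2)) (inv12_mapsV b.2 hb.1 hb.2).1 :
      ContMDiffAt 𝓘(ℝ, E4) 𝓘(ℝ, E4) ∞ glueVHFun b).continuousAt.continuousWithinAt
  continuousOn_invFun b hb := (contMDiffAt_pieceMap (x₀ := oV)
    (contDiffAt_inv12 (r1_ne_zero_of_sq_lt hb.2) hb.1) (inv12_mapsH b.2 hb.1 hb.2).1 :
      ContMDiffAt 𝓘(ℝ, E4) 𝓘(ℝ, E4) ∞ glueHVFun b).continuousAt.continuousWithinAt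

/-- The source of `glueVH`. [folklore] -/
theorem mem_glueVH_source {b : OV R₁} : b ∈ (glueVH : OpenPartialHomeomorph (OV R₁) (OH R₁)).source ↔
    r1 b.1 ≠ 0 ∧ R₁ ^ 2 < r2 b.1 := Iff.rfl

/-- The target of `glueVH`. [folklore] -/
theorem mem_glueVH_target {b : OH R₁} : b ∈ (glueVH : OpenPartialHomeomorph (OV R₁) (OH R₁)).target ↔
    r2 b.1 ≠ 0 ∧ R₁ ^ 2 < r1 b.1 := Iff.rfl

/-- `glueVH` as a function. [folklore] -/
theorem glueVH_apply (b : OV R₁) : (glueVH : OpenPartialHomeomorph (OV R₁) (OH R₁)) b = mkH (inv12 b.1) := rfl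

/-- `glueVH.symm` as a function. [folklore] -/
theorem glueVH_symm_apply (b : OH R₁) :
    (glueVH : OpenPartialHomeomorph (OV R₁) (OH R₁)).symm b = mkV (inv12 b.1) := rfl

/-- On the source, the value of `glueVH` is `inv12`. [folklore] -/
theorem val_glueVH {b : OV R₁} (hb : b ∈ (glueVH : OpenPartialHomeomorph (OV R₁) (OH R₁)).source) :
    ((glueVH : OpenPartialHomeomorph (OV R₁) (OH R₁)) b).1 = inv12 b.1 :=
  val_toOpens (inv12_mapsV b.2 hb.1 hb.2).1

/-- `glueVH` is `C^∞` at the points of its source. [folklore] -/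
theorem contMDiffAt_glueVH {b : OV R₁} (hb : b ∈ (glueVH : OpenPartialHomeomorph (OV R₁) (OH R₁)).source) :
    ContMDiffAt 𝓘(ℝ, E4) 𝓘(ℝ, E4) ∞ (glueVH : OpenPartialHomeomorph (OV R₁) (OH R₁)) b :=
  contMDiffAt_pieceMap (x₀ := oH) (contDiffAt_inv12 hb.1 (r2_ne_zero_of_sq_lt hb.2))
    (inv12_mapsV b.2 hb.1 hb.2).1

/-- `glueVH.symm` is `C^∞` at the points of the target. [folklore] -/
theorem contMDiffAt_glueVH_symm {b : OH R₁}
    (hb : b ∈ (glueVH : OpenPartialHomeomorph (OV R₁) (OH R₁)).target) :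
    ContMDiffAt 𝓘(ℝ, E4) 𝓘(ℝ, E4) ∞ (glueVH : OpenPartialHomeomorph (OV R₁) (OH R₁)).symm b :=
  contMDiffAt_pieceMap (x₀ := oV) (contDiffAt_inv12 (r1_ne_zero_of_sq_lt hb.2) hb.1)
    (inv12_mapsH b.2 hb.1 hb.2).1

variable (R₁) in
/-- **The gluing datum of the two sphere charts.** [folklore] -/
def dVH : SmoothGlueData 𝓘(ℝ, E4) 𝓘(ℝ, E4) (OV R₁) (OH R₁) E4 where
  glue := glueVH
  contMDiffOn_glue _ hb := (contMDiffAt_glueVH hb).contMDiffWithinAt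
  contMDiffOn_glue_symm _ hb := (contMDiffAt_glueVH_symm hb).contMDiffWithinAt
  linA := ContinuousLinearEquiv.refl ℝ E4
  linB := ContinuousLinearEquiv.refl ℝ E4

/-- The glue of `dVH` is `glueVH`. [folklore] -/
theorem dVH_glue : (dVH R₁).glue = glueVH := rfl

/-! ## `C₁ = OV ∪ OH` is Hausdorff -/

/-- **The graph of `glueVH` is closed** (on it `|u|²·|z₁|² = 1` and `|z₂|²·|t|² = 1`, closed
conditions which force closure points into the source). [folklore] -/
theorem isClosed_graph_glueVH :
    IsClosed {p : OV R₁ × OH R₁ | p.1 ∈ (dVH R₁).glue.source ∧ (dVH R₁).glue p.1 = p.2} := by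
  rw [dVH_glue]
  apply isClosed_graph_of_closure_subset
  -- the two closed invariants
  have hF : IsClosed {p : OV R₁ × OH R₁ | r1 p.1.1 * r1 p.2.1 = 1 ∧ r2 p.1.1 * r2 p.2.1 = 1} := by
    refine IsClosed.inter (isClosed_eq ?_ continuous_const) (isClosed_eq ?_ continuous_const)
    · exact (continuous_r1.comp (continuous_subtype_val.comp continuous_fst)).mul
        (continuous_r1.comp (continuous_subtype_val.comp continuous_snd))
    · exact (continuous_r2.comp (continuous_subtype_val.comp continuous_fst)).mul
        (continuous_r2.comp (continuous_subtype_val.comp continuous_snd))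
  have hsub : {p : OV R₁ × OH R₁ | p.1 ∈ glueVH.source ∧ glueVH p.1 = p.2} ⊆
      {p | r1 p.1.1 * r1 p.2.1 = 1 ∧ r2 p.1.1 * r2 p.2.1 = 1} := by
    rintro ⟨b, h⟩ ⟨hb, hbh⟩
    have hb' : b ∈ (glueVH : OpenPartialHomeomorph (OV R₁) (OH R₁)).source := hb
    have hh : h = glueVH b := hbh.symm
    simp only [mem_setOf_eq, hh, val_glueVH hb', r1_inv12, r2_inv12]
    exact ⟨mul_inv_cancel₀ hb'.1, mul_inv_cancel₀ (r2_ne_zero_of_sq_lt hb'.2)⟩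
  intro p hp
  obtain ⟨h1, h2⟩ := closure_minimal hsub hF hp
  refine ⟨left_ne_zero_of_mul_eq_one h1, ?_⟩
  have ht : r2 p.2.1 < R₁⁻¹ ^ 2 := p.2.2
  have hpos : 0 < r2 p.2.1 :=
    lt_of_le_of_ne (r2_nonneg _) (Ne.symm (right_ne_zero_of_mul_eq_one h2))
  rw [eq_inv_of_mul_eq_one_left h2]
  rw [inv_pow] at ht
  exact (lt_inv_comm₀ hpos (by have := hR.out; positivity)).1 ht

/-- `instance`: the first stage `C₁ = OV ∪ OH` of the cap is Hausdorff. [folklore] -/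
instance : T2Space (dVH R₁).Glued := (dVH R₁).t2Space_of_isClosed_graph isClosed_graph_glueVH

/-! ## Holomorphy of the gluing map; consistency of the cap forms -/

/-- The differential of `glueVH` on the source is `D(inv12)`. [folklore] -/
theorem mfderiv_glueVH {b : OV R₁} (hb : b ∈ (dVH R₁).glue.source) (v : E4) :
    mfderiv 𝓘(ℝ, E4) 𝓘(ℝ, E4) (dVH R₁).glue b v = fderiv ℝ inv12 b.1 v :=
  mfderiv_pieceMap (x₀ := oH) (contDiffAt_inv12 hb.1 (r2_ne_zero_of_sq_lt hb.2))
    (inv12_mapsV b.2 hb.1 hb.2).1 v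

/-- **`glueVH` is `(JV, JH)`-holomorphic.** [folklore] -/
theorem hol_VH : ∀ b ∈ (dVH R₁).glue.source, ∀ v : E4,
    mfderiv 𝓘(ℝ, E4) 𝓘(ℝ, E4) (dVH R₁).glue b (JV R₁ b v) =
      JH R₁ ((dVH R₁).glue b) (mfderiv 𝓘(ℝ, E4) 𝓘(ℝ, E4) (dVH R₁).glue b v) := by
  intro b hb v
  rw [JV_apply, JH_apply, mfderiv_glueVH hb, mfderiv_glueVH hb,
    fderiv_inv12_I4 hb.1 (r2_ne_zero_of_sq_lt hb.2)]

/-- **`glueVH^* βH = βV` on the source** (`inv1^*(inv2^* ΩH) = inv1^* ΩM = ΩV`). [folklore] -/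
theorem compat_VH : ∀ b ∈ (dVH R₁).glue.source, (βH R₁).pullback 𝓘(ℝ, E4) (dVH R₁).glue b = βV R₁ b := by
  intro b hb
  have h1 : r1 b.1 ≠ 0 := hb.1
  have h2 : r2 b.1 ≠ 0 := r2_ne_zero_of_sq_lt hb.2
  rw [dVH_glue, show ((glueVH : OpenPartialHomeomorph (OV R₁) (OH R₁)) : OV R₁ → OH R₁) =
    toOpens (OH R₁) oH ∘ inv12 ∘ Subtype.val from rfl, βH,
    pullback_pieceMap (contDiffAt_inv12 h1 h2) (inv12_mapsV b.2 h1 hb.2).1,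
    show inv12 = inv2 ∘ inv1 from rfl,
    pullback_comp_apply_pt _ (differentiableAt_inv2 (by rwa [r2_inv1])) (differentiableAt_inv1 h1)]
  ext u
  rw [MForm.pullback_apply, ΩH_pullback_inv2 R₁ (by rwa [r2_inv1]), ← MForm.pullback_apply,
    ΩM_pullback_inv1 R₁ h1, βV]
  exact (MForm.pullback_subtypeVal_apply (ΩV R₁) b u).symm

variable (R₁) in
/-- **The complex structure of `C₁`** (glued from `i ⊕ i` on both charts). [folklore] -/
def J₁ : AlmostComplexStructure 𝓘(ℝ, E4) ∞ (dVH R₁).Glued := GlueJ.glueACS (dVH R₁) (JV R₁) (JH R₁) hol_VH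

variable (R₁) in
/-- **The cap form of `C₁`** (glued from `ΩV|`, `ΩH|`). [folklore] -/
def β₁ : MForm 𝓘(ℝ, E4) (dVH R₁).Glued ℝ 2 := GlueF.glueForm (dVH R₁) (βV R₁) (βH R₁)

/-- `β₁` is smooth and closed and tames `J₁`. [folklore] -/
theorem β₁_smooth_closed_tame : IsSmoothForm (β₁ R₁) ∧ IsClosedForm (β₁ R₁) ∧ (J₁ R₁).IsTamedBy (β₁ R₁) := by
  obtain ⟨⟨hVs, hVc⟩, ⟨hHs, hHc⟩, -⟩ := βVHC_smooth_closed (R₁ := R₁)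
  obtain ⟨htV, htH, -⟩ := βVHC_tame (R₁ := R₁)
  exact ⟨GlueF.isSmoothForm_glueForm _ compat_VH hVs hHs,
    GlueF.isClosedForm_glueForm _ compat_VH hVs hHs hVc hHc,
    GlueF.glueForm_tames _ compat_VH hol_VH htV htH⟩

end CapModel

/-- **Registered helper sub-goal `helper_capModelClosedGraph`** (file `Cap2` of stub
`stub_capModel`): closed-graph criterion for gluing maps — the graph of a partial homeomorphism
into a Hausdorff space is closed once its closure projects into the source. [folklore] -/
theorem helper_capModelClosedGraph : ∀ (A B : Type) [TopologicalSpace A] [TopologicalSpace B]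
    [T2Space B] (e : OpenPartialHomeomorph A B),
    (∀ p ∈ closure {p : A × B | p.1 ∈ e.source ∧ e p.1 = p.2}, p.1 ∈ e.source) →
    IsClosed {p : A × B | p.1 ∈ e.source ∧ e p.1 = p.2} :=
  fun _ _ _ _ _ e h => CapModel.isClosed_graph_of_closure_subset e h

end Summit.SmoothPoincare4.SmoothPoincare4.Theorems.GromovRecognitionRelEnd.CrossCapLaurent
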